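import Summits.HubbardSuperconductivity.HubbardSuperconductivity.Theorems.AnisotropyChordDressHalfFilledSecondOrderLower
import Summits.HubbardSuperconductivity.HubbardSuperconductivity.Theorems.LevyLogBootstrapDressHalfFilledDictionaryOfData
import Summits.HubbardSuperconductivity.HubbardSuperconductivity.Theorems.LevyLogBootstrapDressHalfFilledStubPlaquetteDictionary
import HarnessLib

/-!
# Crux `DressHalfFilled` (stmt-HubbardSuperconductivity-8148, routes `AnisotropyChord` / `LevyLogBootstrap`), stub 3
# `stub_dressHalfFilled`: the second-order LOWER bound ON THE PLAQUETTE TORUS, given the sector gap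

Helper file (`--supports stmt-HubbardSuperconductivity-8148`), the instance of `…SecondOrderLower.minEnergyOn_ge_second_order` for
`H₀ = H_in = hamiltonian G_intra 1 U`, `T = hamiltonian G_inter 1 0`, `K = szSector (L² − 2N_b) 0`, `E₀ = E₀(N_b)`,
`Φ = dictionaryMap M U`, `P = eigenProj H₀ E₀`, `S = reducedResolvent H₀ E₀`.

The dictionary inputs are discharged from the tree: `E₀(N_b)` IS the sector energy and its eigenspace in the sector is
`Φ(boson sector)` (`dictionary_exhaustion`, from the (W3)–(W5) clauses of `PlaquetteData U`); hence the first-order term vanishes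
on `P K` (`…FirstOrderVanishes`) and the second-order form on `P K` is the XXZ form of clause (d)
(`dictionaryMap_kernel_clause_of_unique`): `Re⟨T Pv, S T Pv⟩ = −Re⟨φ, (2J·XXZ(Δ_eff) + k)φ⟩`, `Pv = Φφ`. What is NOT
discharged (hypotheses, volume-dependent): the GAP `g` of `H_in − E₀` on `K ∩ ker P`, the form bound `τ` of `T` on `K`, and
a unit vector in `K`.

* `eigenProj_mulVec_mem_szSector` — `P` preserves the `(N, S^z)` sectors (functional calculus);
* `plaquette_sectorEnergy_ge_second_order` — for `M ≥ 3`, `PlaquetteData U`, `N_b ≤ M²`: with `k` of clause (d), for every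
  `κ ≥ 0` bounding `−Re⟨φ, (2J·XXZ(Δ_eff) + k(N_b))φ⟩ ≤ κ‖φ‖²` on the boson sector, every gap `g > 0` and form bound `τ` as
  above, and `0 ≤ t'`, `t'τ < g`:  **`E₀(N_b) − t'²κ/(1 − t'τ/g) ≤ E_{(L²−2N_b,0)}(H_in + t' T)`**.
  Together with `…SecondOrderUpperXXZ`: `E = E₀ + t'²·inf spec_sector(2J·XXZ(Δ_eff) + k) + O_L(t'³)` whenever that infimum
  is `≤ 0` — the effective XXZ gas to second order, as a two-sided energy statement at fixed `L`.

HONEST LABEL: fixed-`L` energy asymptotics only (gap and `τ` degrade with `L`); says nothing about ground STATES or order and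
nothing uniform in `L`; the content of stub 3 is untouched; no crux and no summit statement is proved.
Sources: T. Kato (1966) II-§2.3 [Kato1966]; W.-F. Tsai, S. A. Kivelson, PRB 73 (2006) 214510, App. A [TsaiKivelson2006].
No definition and no named fact is introduced; sorry-free.
-/

noncomputable section

-- `dupNamespace`: the summit and the problem are both named `HubbardSuperconductivity` (layout D-0022)
set_option linter.dupNamespace false

namespace Summit.HubbardSuperconductivity.HubbardSuperconductivity.Theorems.AnisotropyChord.DressSecond

open Matrix Literature.MathematicalPhysics.QuantumLattice Literature.Probability.LatticeModels
open Literature.MathematicalPhysics.QuantumLattice.TorusPlaquette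
open Summit.HubbardSuperconductivity.HubbardSuperconductivity.Theorems.LevyLogBootstrap
  (PlaquetteData dictionaryMap_kernel_clause_of_unique dictionary_exhaustion)
open scoped ComplexOrder

/-! ### The eigenprojection of a Hubbard Hamiltonian preserves the sectors -/

section Sector

variable {Λ : Type*} [LinearOrder Λ] [Fintype Λ]

/-- `P = eigenProj (hamiltonian G t U) E` maps every joint sector `szSector N M` into itself (a real functional calculus
of a matrix commuting with `N` and `S^z`; instance by unification as in `reducedResolvent_mulVec_mem_szSector`). [folklore] -/
theorem eigenProj_mulVec_mem_szSector {hdec : DecidableEq (Finset (Orb Λ))} (G : SimpleGraph Λ)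
    [DecidableRel G.Adj] (t U E : ℝ) {N : ℕ} {Mz : ℝ} {v : Fock (Orb Λ)} (hv : v ∈ szSector N Mz) :
    eigenProj (hamiltonian G t U) E *ᵥ v ∈ szSector N Mz := by
  obtain ⟨-, hN, hS⟩ := hamiltonian_isHermitian_and_commute_holds G t U
  have hN' : Commute (eigenProj (hamiltonian G t U) E) totalNumber := by
    rw [eigenProj]; exact hN.cfc_real _
  have hS' : Commute (eigenProj (hamiltonian G t U) E) HubbardWave0.spinZ := by
    rw [eigenProj]; exact hS.cfc_real _
  exact mulVec_mem_szSector_of_commute hN' hS' hv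

end Sector

/-! ### The instance -/

section Plaquette

variable {M : ℕ} [NeZero M]

set_option linter.style.longLine false in
/-- **Second-order lower bound for the boson-sector energies of the checkerboard Hubbard torus, given the sector gap.**
`M ≥ 3`, `PlaquetteData U`, `N_b ≤ M²`; `H₀ = H_in`, `T = hamiltonian G_inter 1 0`, `K = szSector (L² − 2N_b) 0`,
`E₀ = (M² − N_b)E(0h) + N_b E(2h)`, `P = eigenProj H₀ E₀`. There is `k : ℕ → ℝ` (clause (d)) such that: for every `κ ≥ 0` with
`−Re⟨φ, (2J·XXZ(Δ_eff) + k(N_b)·1)φ⟩ ≤ κ‖φ‖²` on the boson sector `S^z_tot = N_b − M²/2`, every `g > 0` with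
`H₀ − E₀ ≥ g` on `K ∩ ker P`, every `τ` with `|Re⟨v, Tv⟩| ≤ τ‖v‖²` on `K`, provided `K` carries a unit vector, and all
`0 ≤ t'` with `t'τ < g`: `E₀ − t'²κ/(1 − t'τ/g) ≤ E_K(H₀ + t' T)`. Kato (1966) II-§2.3; Tsai–Kivelson (2006) App. A.
[folklore] -/
theorem plaquette_sectorEnergy_ge_second_order (hM : 3 ≤ M) {U : ℝ} (hPD : PlaquetteData U) :
    ∃ k : ℕ → ℝ, ∀ (Nb : ℕ), Nb ≤ M ^ 2 → ∀ (κ g τ : ℝ), 0 ≤ κ → 0 < g →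
      (∀ φ : TensorIndex (TorusSite 2 M) 2 → ℂ, φ ∈ spinZSector (Λ := TorusSite 2 M) 1 ((Nb : ℝ) - (M : ℝ) ^ 2 / 2) →
        -(star φ ⬝ᵥ ((((2 * (plaquettePairCouplings U).J : ℝ) : ℂ) •
            xxzHamiltonian 1 (torusGraph 2 M) (-1) (plaquettePairCouplings U).ΔEff + ((k Nb : ℝ) : ℂ) • 1) *ᵥ φ)).re ≤
          κ * (star φ ⬝ᵥ φ).re) →
      (∀ v : Fock (Orb (FermionTorus 2 (2 * M))), v ∈ szSector (Λ := FermionTorus 2 (2 * M)) ((2 * M) ^ 2 - 2 * Nb) 0 →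
        eigenProj (hamiltonian (fermionTorusGraph 2 (2 * M) \
          SimpleGraph.comap (fun x : FermionTorus 2 (2 * M) => fun i : Fin 2 => ((ofLex x) i : ℕ) / 2) ⊤) 1 U)
          (((M : ℝ) ^ 2 - Nb) * plaquetteEnergy U 0 + Nb * plaquetteEnergy U 2) *ᵥ v = 0 →
        g * (star v ⬝ᵥ v).re ≤ (star v ⬝ᵥ (hamiltonian (fermionTorusGraph 2 (2 * M) \
          SimpleGraph.comap (fun x : FermionTorus 2 (2 * M) => fun i : Fin 2 => ((ofLex x) i : ℕ) / 2) ⊤) 1 U *ᵥ v)).re -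
          (((M : ℝ) ^ 2 - Nb) * plaquetteEnergy U 0 + Nb * plaquetteEnergy U 2) * (star v ⬝ᵥ v).re) →
      (∀ v : Fock (Orb (FermionTorus 2 (2 * M))), v ∈ szSector (Λ := FermionTorus 2 (2 * M)) ((2 * M) ^ 2 - 2 * Nb) 0 →
        |(star v ⬝ᵥ (hamiltonian (fermionTorusGraph 2 (2 * M) ⊓
          SimpleGraph.comap (fun x : FermionTorus 2 (2 * M) => fun i : Fin 2 => ((ofLex x) i : ℕ) / 2) ⊤) 1 0 *ᵥ v)).re| ≤
          τ * (star v ⬝ᵥ v).re) →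
      (∃ v : Fock (Orb (FermionTorus 2 (2 * M))), v ∈ szSector (Λ := FermionTorus 2 (2 * M)) ((2 * M) ^ 2 - 2 * Nb) 0 ∧
        star v ⬝ᵥ v = 1) →
      ∀ t' : ℝ, 0 ≤ t' → t' * τ < g →
    (((M : ℝ) ^ 2 - Nb) * plaquetteEnergy U 0 + Nb * plaquetteEnergy U 2) - t' ^ 2 * κ / (1 - t' * τ / g) ≤
      (hamiltonian (fermionTorusGraph 2 (2 * M) \
          SimpleGraph.comap (fun x : FermionTorus 2 (2 * M) => fun i : Fin 2 => ((ofLex x) i : ℕ) / 2) ⊤) 1 U +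
        (t' : ℂ) • hamiltonian (fermionTorusGraph 2 (2 * M) ⊓
          SimpleGraph.comap (fun x : FermionTorus 2 (2 * M) => fun i : Fin 2 => ((ofLex x) i : ℕ) / 2) ⊤) 1 0).minEnergyOn
        (szSector (Λ := FermionTorus 2 (2 * M)) ((2 * M) ^ 2 - 2 * Nb) 0) := by
  have hM2 : 2 ≤ M := le_trans (by norm_num) hM
  obtain ⟨⟨hJ, -, -⟩, -, ⟨-, -, hW3⟩, hW4a, hW4b, hW5a, hW5b⟩ := hPD
  obtain ⟨k, hk⟩ := dictionaryMap_kernel_clause_of_unique (M := M) hJ.ne' hW4a hW4b hM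
  refine ⟨k, fun Nb hNb κ g τ hκ hg hform hgap hτ hne t' ht0 htg => ?_⟩
  obtain ⟨hmin, hexh⟩ := dictionary_exhaustion hM2 U hW3 hW4a hW4b hW5a hW5b hNb
  have hH₀ := (hamiltonian_isHermitian_and_commute_holds (fermionTorusGraph 2 (2 * M) \
    SimpleGraph.comap (fun x : FermionTorus 2 (2 * M) => fun i : Fin 2 => ((ofLex x) i : ℕ) / 2) ⊤) 1 U).1
  have hT := (hamiltonian_isHermitian_and_commute_holds (fermionTorusGraph 2 (2 * M) ⊓
    SimpleGraph.comap (fun x : FermionTorus 2 (2 * M) => fun i : Fin 2 => ((ofLex x) i : ℕ) / 2) ⊤) 1 0).1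
  -- `H₀ ≥ E₀` on the sector: `E₀` is the sector energy
  have hE₀ : ∀ v ∈ szSector (Λ := FermionTorus 2 (2 * M)) ((2 * M) ^ 2 - 2 * Nb) 0,
      (((M : ℝ) ^ 2 - Nb) * plaquetteEnergy U 0 + Nb * plaquetteEnergy U 2) * (star v ⬝ᵥ v).re ≤
        (star v ⬝ᵥ (hamiltonian (fermionTorusGraph 2 (2 * M) \
          SimpleGraph.comap (fun x : FermionTorus 2 (2 * M) => fun i : Fin 2 => ((ofLex x) i : ℕ) / 2) ⊤) 1 U *ᵥ v)).re := by
    intro v hv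
    by_cases hv0 : (star v ⬝ᵥ v).re = 0
    · -- then `v = 0`
      have hvz : v = 0 := by
        have h1 : star v ⬝ᵥ v = 0 := by
          rw [star_dotProduct_self_eq_re v, hv0, Complex.ofReal_zero]
        exact dotProduct_star_self_eq_zero.1 h1
      rw [hvz, mulVec_zero, dotProduct_zero, Complex.zero_re, mul_zero]
    · have hpos : 0 < (star v ⬝ᵥ v).re :=
        lt_of_le_of_ne (Complex.nonneg_iff.mp (dotProduct_star_self_nonneg v)).1 (Ne.symm hv0)
      have h := minEnergyOn_le_rayleigh_div' hH₀ _ hv hpos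
      rw [hmin, le_div_iff₀ hpos] at h
      exact h
  -- the points of `P K` are dictionary states
  have hPK : ∀ v ∈ szSector (Λ := FermionTorus 2 (2 * M)) ((2 * M) ^ 2 - 2 * Nb) 0,
      ∃ φ : TensorIndex (TorusSite 2 M) 2 → ℂ, φ ∈ spinZSector (Λ := TorusSite 2 M) 1 ((Nb : ℝ) - (M : ℝ) ^ 2 / 2) ∧
        eigenProj (hamiltonian (fermionTorusGraph 2 (2 * M) \
            SimpleGraph.comap (fun x : FermionTorus 2 (2 * M) => fun i : Fin 2 => ((ofLex x) i : ℕ) / 2) ⊤) 1 U)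
            (((M : ℝ) ^ 2 - Nb) * plaquetteEnergy U 0 + Nb * plaquetteEnergy U 2) *ᵥ v =
          dictionaryMap M U *ᵥ φ := by
    intro v hv
    have hPv : eigenProj (hamiltonian (fermionTorusGraph 2 (2 * M) \
            SimpleGraph.comap (fun x : FermionTorus 2 (2 * M) => fun i : Fin 2 => ((ofLex x) i : ℕ) / 2) ⊤) 1 U)
            (((M : ℝ) ^ 2 - Nb) * plaquetteEnergy U 0 + Nb * plaquetteEnergy U 2) *ᵥ v ∈
        szSector (Λ := FermionTorus 2 (2 * M)) ((2 * M) ^ 2 - 2 * Nb) 0 :=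
      eigenProj_mulVec_mem_szSector _ 1 U _ hv
    exact hexh _ hPv (mulVec_eigenProj_mulVec hH₀ _ v)
  refine minEnergyOn_ge_second_order hH₀ hT _ hne
    (fun v hv => hamiltonian_mulVec_mem_szSector _ 1 0 hv)
    (fun v hv => reducedResolvent_mulVec_mem_szSector _ 1 U _ hv)
    (fun v hv => eigenProj_mulVec_mem_szSector _ 1 U _ hv)
    hE₀ hg hgap hτ ?_ hκ ?_ ht0 htg
  · -- no first-order term on `P K`
    intro v hv
    obtain ⟨φ, -, hφ⟩ := hPK v hv
    rw [hφ, DressFirst.star_dictionaryMap_mulVec_dotProduct_hamiltonian_inter hM2 U φ φ, Complex.zero_re]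
  · -- the second-order form on `P K` is the XXZ form (clause (d))
    intro v hv
    obtain ⟨φ, hφK, hφ⟩ := hPK v hv
    rw [hφ]
    have hd := hk Nb hNb φ φ hφK hφK
    -- `⟨T a, S T a⟩ = ⟨a, (T S T) a⟩` with the two spellings of `E₀`
    have hmove : star (dictionaryMap M U *ᵥ φ) ⬝ᵥ ((hamiltonian (fermionTorusGraph 2 (2 * M) ⊓
            SimpleGraph.comap (fun x : FermionTorus 2 (2 * M) => fun i : Fin 2 => ((ofLex x) i : ℕ) / 2) ⊤) 1 0 *
            reducedResolvent (hamiltonian (fermionTorusGraph 2 (2 * M) \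
              SimpleGraph.comap (fun x : FermionTorus 2 (2 * M) => fun i : Fin 2 => ((ofLex x) i : ℕ) / 2) ⊤) 1 U)
              (((M : ℝ) ^ 2 - (Nb : ℝ)) * (plaquettePairCouplings U).E 0 + (Nb : ℝ) * (plaquettePairCouplings U).E 2) *
            hamiltonian (fermionTorusGraph 2 (2 * M) ⊓
              SimpleGraph.comap (fun x : FermionTorus 2 (2 * M) => fun i : Fin 2 => ((ofLex x) i : ℕ) / 2) ⊤) 1 0) *ᵥ
          (dictionaryMap M U *ᵥ φ)) =
        star (hamiltonian (fermionTorusGraph 2 (2 * M) ⊓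
            SimpleGraph.comap (fun x : FermionTorus 2 (2 * M) => fun i : Fin 2 => ((ofLex x) i : ℕ) / 2) ⊤) 1 0 *ᵥ
              (dictionaryMap M U *ᵥ φ)) ⬝ᵥ
          (reducedResolvent (hamiltonian (fermionTorusGraph 2 (2 * M) \
              SimpleGraph.comap (fun x : FermionTorus 2 (2 * M) => fun i : Fin 2 => ((ofLex x) i : ℕ) / 2) ⊤) 1 U)
              (((M : ℝ) ^ 2 - Nb) * plaquetteEnergy U 0 + Nb * plaquetteEnergy U 2) *ᵥ
            (hamiltonian (fermionTorusGraph 2 (2 * M) ⊓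
              SimpleGraph.comap (fun x : FermionTorus 2 (2 * M) => fun i : Fin 2 => ((ofLex x) i : ℕ) / 2) ⊤) 1 0 *ᵥ
                (dictionaryMap M U *ᵥ φ))) := by
      rw [← mulVec_mulVec, ← mulVec_mulVec, RayleighBottom.star_dotProduct_mulVec_eq, hT.eq]
      rfl
    rw [hmove] at hd
    rw [hd, Complex.neg_re]
    -- `‖Φφ‖² = ‖φ‖²`
    have hiso : star (dictionaryMap M U *ᵥ φ) ⬝ᵥ (dictionaryMap M U *ᵥ φ) = star φ ⬝ᵥ φ := by
      rw [star_mulVec, ← dotProduct_mulVec, mulVec_mulVec, dictionaryMap_conjTranspose_mul_self, one_mulVec]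
    rw [hiso]
    exact hform φ hφK

end Plaquette

end Summit.HubbardSuperconductivity.HubbardSuperconductivity.Theorems.AnisotropyChord.DressSecond

end
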